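import Literature.NumberTheory.EllipticCurves.ZpExtensionGaloisTwistSharpFlatSelmerStructure
import Literature.NumberTheory.EllipticCurves.ZpExtensionGaloisTwistUnramifiedProofs
import Summits.BirchSwinnertonDyer.Rank1Residual.GaloisImage.SelmerGroupFinite
import Literature.NumberTheory.EllipticCurves.ZpExtensionGaloisTwistWeilDual
import Literature.NumberTheory.EllipticCurves.WeilPairingTateDual
import Mathlib.GroupTheory.Coset.Card
import HarnessLib

/-!
# Route `ByReductionTypeAtTwo` (rung K4), crux `SupersingularRankZeroAtTwo` (item stmt-BirchSwinnertonDyer-19097), line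
# `odd_blind_package` slot 5 (CDF_glob): BRICK 2a — THE COUNT SKELETON for the twisted Selmer structures with a prescribed
# local condition at ONE place above `p`: `#H¹_{𝓕^{L[v↦X]}} ≤ #H¹_{𝓕^{L[v↦0]}} · [H¹_{𝓕^{L[v↦⊤]}} : H¹_{𝓕^{L[v↦K]}}] · #(X ⊓ K)`
# (cell `bsd-2adic`, seat `t42` GEN 37; pen SUMMON 20260831T021031Z; memo HOME/t42/CDFGLOB-DEFS-GEN37.md §3)

HONEST FRAMING: THEOREMS ONLY (no definition, no named fact, no `sorry`, no instance); elementary group theory over the (D)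
structures `WeierstrassCurve.twistedSelmerStructureOfLocal` (Literature `ZpExtensionGaloisTwistSharpFlatSelmerStructure`); closes
nothing; BSD is proved for no curve by any of this. bears_on: K4 (19097), `--supports stmt-BirchSwinnertonDyer-19097`.

## What is proved (any number field `K : Type`, prime `p`, unit twist `χ_u`, base family `L` of local conditions at the places
## above `p`, a distinguished `v ∋ p` outside `S₀`, subgroups `X`, `K'` of `H¹(K_v, E[p^J](χ_u))`)

Write `𝓕^Y := twistedSelmerStructureOfLocal p S₀ κ J u hu (Function.update L v Y)` and `H_Y := H¹_{𝓕^Y}(K, E[p^J](χ_u))`.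
* §1 the structures `𝓕^Y`, `𝓕^{Y'}` agree at every place `≠ v` (`twistedSelmerStructureOfLocal_update_apply_of_ne`); hence for
  `x ∈ H_{Y'}`: `x ∈ H_Y ↔ loc_v x ∈ Y` (`mem_selmerGroup_update_iff`); monotonicity `Y ≤ Y' ⇒ H_Y ≤ H_{Y'}`.
* §2 ★ `natCard_selmerGroup_update_le`: if `H_⊤` and `X ⊓ K'` are finite then
  `#H_X ≤ #H_⊥ · #(H_⊤ ⧸ H_{K'}) · #(X ⊓ K')` — `loc_v` on `H_X` has kernel `H_⊥` and image in `X ⊓ loc_v(H_⊤)`, and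
  `(X ⊓ loc_v H_⊤) → H¹(K_v)/K'` has kernel inside `X ⊓ K'` and image `≅ H_⊤/H_{K'}`.
* §3 the level-`K` finiteness input: `H_⊤` is finite when `E` has good reduction outside `S₀ ∪ {v ∣ p}`
  (`finite_selmerGroup_of_isUnramifiedOutside` + `natCast_pow_not_mem_and_isUnramifiedAt_twistedTorsionGaloisModule`), and the
  uniform-bound corollary `exists_uniform_bound_selmerGroup_update`: bounds `#H_{⊥,J} · #(H_{⊤,J} ⧸ H_{K'_J}) ≤ C₁` and
  `#(X_J ⊓ K'_J) ≤ C₂` for all `J` give `#H_{X_J} ≤ C₁ C₂` for all `J`. For the ss line (`K = ℚ`, `p = 2`, `u = −1`,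
  `X_J = L♭_J` Sprung's ♭ condition, `K'_J` the Kummer line of the twist) these two inputs are the hand targets HT-2 / HT-1 and the
  output feeds HT-3 (memo §3); `𝓕^{L♭} = twistedSharpFlatSelmerStructure …` definitionally.

References: [GreenbergLNM1716] §4 pp. 122–124 (strict / relaxed local conditions at `p`); [MilneADT2006] I §4 (Selmer conditions).
-/

set_option autoImplicit false
set_option linter.dupNamespace false

noncomputable section

open scoped Classical NumberField

namespace Summit.BirchSwinnertonDyer.BirchSwinnertonDyer.Theorems

namespace OddBlindTwist

open NumberField IsDedekindDomain Field WeierstrassCurve Literature.NumberTheory.EllipticCurves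
  Literature.NumberTheory.GaloisRepresentations Literature.NumberTheory.GaloisCohomology ZpExtension
open Literature.NumberTheory.GaloisRepresentations.DiscreteGaloisModule (unramifiedSubgroup SelmerStructure)

section Count

variable {K : Type} [Field K] [NumberField K] (W : WeierstrassCurve K) (p : ℕ) [Fact p.Prime]
  (S₀ : Finset (HeightOneSpectrum (𝓞 K))) (κ : ZpExtension K p) (J : ℕ) (u : ℤ) (hu : (p : ℤ) ∣ u - 1)
  (L : ∀ v : HeightOneSpectrum (𝓞 K),
    AddSubgroup (galoisCohomology ((W.twistedTorsionGaloisModule p κ J u hu).restrictField (v.adicCompletion K)) 1))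
  (v : HeightOneSpectrum (𝓞 K))

/-! ## §1 Changing the condition at the distinguished place only -/

/-- `𝓕^{L[v↦Y]}` and `𝓕^{L[v↦Y']}` agree at every place other than `Sum.inr v`. [cite: GreenbergLNM1716, §4 p. 123] -/
theorem twistedSelmerStructureOfLocal_update_apply_of_ne
    (Y Y' : AddSubgroup (galoisCohomology ((W.twistedTorsionGaloisModule p κ J u hu).restrictField (v.adicCompletion K)) 1))
    {w : Place K} (hw : w ≠ Sum.inr v) :
    W.twistedSelmerStructureOfLocal p S₀ κ J u hu (Function.update L v Y) w =
      W.twistedSelmerStructureOfLocal p S₀ κ J u hu (Function.update L v Y') w := by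
  rcases w with w | v'
  · rfl
  · have hv' : v' ≠ v := fun h ↦ hw (by rw [h])
    by_cases hS : v' ∈ S₀
    · rw [W.twistedSelmerStructureOfLocal_inr_of_mem p S₀ κ J u hu _ hS,
        W.twistedSelmerStructureOfLocal_inr_of_mem p S₀ κ J u hu _ hS]
    · by_cases hpv' : ((p : ℕ) : 𝓞 K) ∈ v'.asIdeal
      · rw [W.twistedSelmerStructureOfLocal_inr_of_mem_asIdeal p S₀ κ J u hu _ hS hpv',
          W.twistedSelmerStructureOfLocal_inr_of_mem_asIdeal p S₀ κ J u hu _ hS hpv',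
          Function.update_of_ne hv', Function.update_of_ne hv']
      · rw [W.twistedSelmerStructureOfLocal_inr_of_not_mem p S₀ κ J u hu _ hS hpv',
          W.twistedSelmerStructureOfLocal_inr_of_not_mem p S₀ κ J u hu _ hS hpv']

variable (hvS : v ∉ S₀) (hpv : ((p : ℕ) : 𝓞 K) ∈ v.asIdeal)
include hvS hpv

/-- `𝓕^{L[v↦Y]}` at the distinguished place is `Y`. [cite: GreenbergLNM1716, §4 p. 123] -/
theorem twistedSelmerStructureOfLocal_update_apply_self
    (Y : AddSubgroup (galoisCohomology ((W.twistedTorsionGaloisModule p κ J u hu).restrictField (v.adicCompletion K)) 1)) :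
    W.twistedSelmerStructureOfLocal p S₀ κ J u hu (Function.update L v Y) (Sum.inr v) = Y := by
  rw [W.twistedSelmerStructureOfLocal_inr_of_mem_asIdeal p S₀ κ J u hu _ hvS hpv, Function.update_self]

/-- **For a class of `H_{Y'}`, membership in `H_Y` is the condition `loc_v x ∈ Y` alone.** [cite: GreenbergLNM1716, §4 p. 123] -/
theorem mem_selmerGroup_update_iff
    (Y Y' : AddSubgroup (galoisCohomology ((W.twistedTorsionGaloisModule p κ J u hu).restrictField (v.adicCompletion K)) 1))
    {x : galoisCohomology (W.twistedTorsionGaloisModule p κ J u hu) 1}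
    (hx : x ∈ (W.twistedSelmerStructureOfLocal p S₀ κ J u hu (Function.update L v Y')).selmerGroup) :
    x ∈ (W.twistedSelmerStructureOfLocal p S₀ κ J u hu (Function.update L v Y)).selmerGroup ↔
      galoisCohomology.res (W.twistedTorsionGaloisModule p κ J u hu) (v.adicCompletion K) 1 x ∈ Y := by
  rw [SelmerStructure.mem_selmerGroup_iff] at hx ⊢
  constructor
  · intro h
    have h' := h (Sum.inr v)
    rwa [twistedSelmerStructureOfLocal_update_apply_self W p S₀ κ J u hu L v hvS hpv] at h'
  · intro h w
    by_cases hw : w = Sum.inr v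
    · subst hw
      rw [twistedSelmerStructureOfLocal_update_apply_self W p S₀ κ J u hu L v hvS hpv]
      exact h
    · rw [twistedSelmerStructureOfLocal_update_apply_of_ne W p S₀ κ J u hu L v Y Y' hw]
      exact hx w

omit hvS hpv in
/-- Monotonicity in the condition at `v`: `Y ≤ Y' ⇒ H_Y ≤ H_{Y'}`. [cite: GreenbergLNM1716, §4 p. 123] -/
theorem selmerGroup_update_mono
    {Y Y' : AddSubgroup (galoisCohomology ((W.twistedTorsionGaloisModule p κ J u hu).restrictField (v.adicCompletion K)) 1)}
    (h : Y ≤ Y') :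
    (W.twistedSelmerStructureOfLocal p S₀ κ J u hu (Function.update L v Y)).selmerGroup ≤
      (W.twistedSelmerStructureOfLocal p S₀ κ J u hu (Function.update L v Y')).selmerGroup := by
  intro x hx
  rw [SelmerStructure.mem_selmerGroup_iff] at hx ⊢
  intro w
  refine W.twistedSelmerStructureOfLocal_mono p S₀ κ J u hu (fun v' ↦ ?_) w (hx w)
  by_cases hv' : v' = v
  · subst hv'; rw [Function.update_self, Function.update_self]; exact h
  · rw [Function.update_of_ne hv', Function.update_of_ne hv']

/-! ## §2 The count -/

/-- ★ **The count skeleton.** With `H_Y = H¹_{𝓕^{L[v↦Y]}}`: if `H_⊤` and `X ⊓ K'` are finite, then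
`#H_X ≤ #H_⊥ · #(H_⊤ ⧸ H_{K'}) · #(X ⊓ K')`. (`loc_v|_{H_X}` has kernel `H_⊥` and image in `X ⊓ loc_v(H_⊤)`; the map
`X ⊓ loc_v(H_⊤) → H¹(K_v)/K'` has kernel in `X ⊓ K'` and image `loc_v(H_⊤)/(loc_v(H_⊤) ∩ K') ≅ H_⊤/H_{K'}`.)
[cite: GreenbergLNM1716, §4 pp. 122–124] [cite: MilneADT2006, Ch. I §4] -/
theorem natCard_selmerGroup_update_le
    (X K' : AddSubgroup (galoisCohomology ((W.twistedTorsionGaloisModule p κ J u hu).restrictField (v.adicCompletion K)) 1))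
    (hfin : Finite (W.twistedSelmerStructureOfLocal p S₀ κ J u hu (Function.update L v ⊤)).selmerGroup)
    (hXK : Finite ↥(X ⊓ K')) :
    Nat.card (W.twistedSelmerStructureOfLocal p S₀ κ J u hu (Function.update L v X)).selmerGroup ≤
      Nat.card (W.twistedSelmerStructureOfLocal p S₀ κ J u hu (Function.update L v ⊥)).selmerGroup *
        Nat.card ((W.twistedSelmerStructureOfLocal p S₀ κ J u hu (Function.update L v ⊤)).selmerGroup ⧸
          ((W.twistedSelmerStructureOfLocal p S₀ κ J u hu (Function.update L v K')).selmerGroup).addSubgroupOf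
            (W.twistedSelmerStructureOfLocal p S₀ κ J u hu (Function.update L v ⊤)).selmerGroup) *
        Nat.card ↥(X ⊓ K') := by
  -- notation
  set HX := (W.twistedSelmerStructureOfLocal p S₀ κ J u hu (Function.update L v X)).selmerGroup with hHX
  set H0 := (W.twistedSelmerStructureOfLocal p S₀ κ J u hu (Function.update L v ⊥)).selmerGroup with hH0
  set HT := (W.twistedSelmerStructureOfLocal p S₀ κ J u hu (Function.update L v ⊤)).selmerGroup with hHT
  set HK := (W.twistedSelmerStructureOfLocal p S₀ κ J u hu (Function.update L v K')).selmerGroup with hHK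
  set loc := galoisCohomology.res (W.twistedTorsionGaloisModule p κ J u hu) (v.adicCompletion K) 1 with hloc
  have hXT : HX ≤ HT := selmerGroup_update_mono W p S₀ κ J u hu L v le_top
  have h0X : H0 ≤ HX := selmerGroup_update_mono W p S₀ κ J u hu L v bot_le
  have hKT : HK ≤ HT := selmerGroup_update_mono W p S₀ κ J u hu L v le_top
  haveI : Finite HT := hfin
  haveI : Finite HX := Finite.of_injective _ (AddSubgroup.inclusion_injective hXT)
  -- Step 1: `loc` on `H_X`: kernel `H_⊥`, image inside `X ⊓ loc(H_⊤)`
  let f : HX →+ galoisCohomology ((W.twistedTorsionGaloisModule p κ J u hu).restrictField (v.adicCompletion K)) 1 :=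
    loc.comp HX.subtype
  have hker : f.ker = H0.addSubgroupOf HX := by
    ext x
    rw [AddMonoidHom.mem_ker, AddSubgroup.mem_addSubgroupOf]
    change loc x = 0 ↔ (x : galoisCohomology (W.twistedTorsionGaloisModule p κ J u hu) 1) ∈ H0
    rw [mem_selmerGroup_update_iff W p S₀ κ J u hu L v hvS hpv ⊥ X x.2, AddSubgroup.mem_bot]
  set G := HT.map loc with hG
  have hrange : f.range ≤ X ⊓ G := by
    rintro y ⟨x, rfl⟩
    refine ⟨?_, ⟨x, hXT x.2, rfl⟩⟩
    exact (mem_selmerGroup_update_iff W p S₀ κ J u hu L v hvS hpv X X x.2).1 x.2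
  haveI : Finite G := Finite.of_surjective (fun x : HT ↦ (⟨loc x, ⟨x, x.2, rfl⟩⟩ : G))
    (by rintro ⟨y, x, hx, rfl⟩; exact ⟨⟨x, hx⟩, rfl⟩)
  haveI : Finite ↥(X ⊓ G) := Finite.of_injective _ (AddSubgroup.inclusion_injective (inf_le_right : X ⊓ G ≤ G))
  have h1 : Nat.card HX = Nat.card H0 * Nat.card f.range := by
    rw [AddSubgroup.card_eq_card_quotient_mul_card_addSubgroup f.ker,
      Nat.card_congr (QuotientAddGroup.quotientKerEquivRange f).toEquiv, hker,
      Nat.card_congr (AddSubgroup.addSubgroupOfEquivOfLe h0X).toEquiv, mul_comm]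
  have h2 : Nat.card f.range ≤ Nat.card ↥(X ⊓ G) :=
    Nat.card_le_card_of_injective _ (AddSubgroup.inclusion_injective hrange)
  -- Step 2: `X ⊓ G → H¹(K_v)/K'`: kernel inside `X ⊓ K'`, image `= G.map mk ≅ H_⊤/H_{K'}`
  let g : HT →+ galoisCohomology ((W.twistedTorsionGaloisModule p κ J u hu).restrictField (v.adicCompletion K)) 1 ⧸ K' :=
    (QuotientAddGroup.mk' K').comp (loc.comp HT.subtype)
  have hgker : g.ker = HK.addSubgroupOf HT := by
    ext x
    rw [AddMonoidHom.mem_ker, AddSubgroup.mem_addSubgroupOf]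
    change ((loc x : galoisCohomology ((W.twistedTorsionGaloisModule p κ J u hu).restrictField
      (v.adicCompletion K)) 1) : _ ⧸ K') = 0 ↔ (x : galoisCohomology (W.twistedTorsionGaloisModule p κ J u hu) 1) ∈ HK
    rw [QuotientAddGroup.eq_zero_iff, mem_selmerGroup_update_iff W p S₀ κ J u hu L v hvS hpv K' ⊤ x.2]
  let φ : ↥(X ⊓ G) →+ galoisCohomology ((W.twistedTorsionGaloisModule p κ J u hu).restrictField (v.adicCompletion K)) 1 ⧸ K' :=
    (QuotientAddGroup.mk' K').comp (X ⊓ G).subtype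
  have hφrange : φ.range ≤ g.range := by
    rintro q ⟨⟨y, hyX, x, hx, rfl⟩, rfl⟩
    exact ⟨⟨x, hx⟩, rfl⟩
  have hφker : Nat.card φ.ker ≤ Nat.card ↥(X ⊓ K') := by
    refine Nat.card_le_card_of_injective (fun y : φ.ker ↦ (⟨((y : ↥(X ⊓ G)) : _), ⟨y.1.2.1, ?_⟩⟩ : ↥(X ⊓ K'))) ?_
    · have hy := y.2
      rw [AddMonoidHom.mem_ker] at hy
      exact (QuotientAddGroup.eq_zero_iff _).1 hy
    · intro a b hab
      apply Subtype.ext; apply Subtype.ext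
      exact congrArg (fun z : ↥(X ⊓ K') ↦ (z : galoisCohomology ((W.twistedTorsionGaloisModule p κ J u hu).restrictField
        (v.adicCompletion K)) 1)) hab
  haveI : Finite g.range := Finite.of_surjective (fun x : HT ↦ (⟨g x, ⟨x, rfl⟩⟩ : g.range))
    (by rintro ⟨q, x, rfl⟩; exact ⟨x, rfl⟩)
  have h3 : Nat.card ↥(X ⊓ G) ≤ Nat.card ↥(X ⊓ K') * Nat.card g.range := by
    rw [AddSubgroup.card_eq_card_quotient_mul_card_addSubgroup φ.ker,
      Nat.card_congr (QuotientAddGroup.quotientKerEquivRange φ).toEquiv, mul_comm]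
    exact Nat.mul_le_mul hφker (Nat.card_le_card_of_injective _ (AddSubgroup.inclusion_injective hφrange))
  have h4 : Nat.card g.range = Nat.card (HT ⧸ HK.addSubgroupOf HT) := by
    rw [← Nat.card_congr (QuotientAddGroup.quotientKerEquivRange g).toEquiv, hgker]
  -- assemble
  calc Nat.card HX = Nat.card H0 * Nat.card f.range := h1
    _ ≤ Nat.card H0 * Nat.card ↥(X ⊓ G) := Nat.mul_le_mul_left _ h2
    _ ≤ Nat.card H0 * (Nat.card ↥(X ⊓ K') * Nat.card g.range) := Nat.mul_le_mul_left _ h3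
    _ = Nat.card H0 * Nat.card (HT ⧸ HK.addSubgroupOf HT) * Nat.card ↥(X ⊓ K') := by rw [h4]; ring

/-! ## §3 Finiteness of `H_⊤` at level `K`, and the uniform-bound corollary -/

omit hvS hpv in
/-- **`H¹_{𝓕^{L'}}(K, E[p^J](χ_u))` is finite for every family `L'`** when `E` has good reduction at every place outside
`S₀ ∪ {v ∣ p}`: the structure is unramified outside `S = {∞} ∪ S₀ ∪ {v ∣ p}` and the finite module `E[p^J](χ_u)` is unramified
there (Néron–Ogg–Shafarevich + `K_∞/K` unramified outside `p`), so the tree's `finite_selmerGroup_of_isUnramifiedOutside`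
(Hermite–Minkowski, Silverman VIII.1.6 / X.4.3) applies. [cite: GreenbergLNM1716, §4 p. 124] -/
theorem finite_selmerGroup_ofLocal [W.IsElliptic]
    (hbad : ∀ v' : HeightOneSpectrum (𝓞 K), v' ∉ S₀ → ((p : ℕ) : 𝓞 K) ∉ v'.asIdeal → W.HasGoodReductionAt v')
    (L' : ∀ v' : HeightOneSpectrum (𝓞 K),
      AddSubgroup (galoisCohomology ((W.twistedTorsionGaloisModule p κ J u hu).restrictField (v'.adicCompletion K)) 1)) :
    Finite (W.twistedSelmerStructureOfLocal p S₀ κ J u hu L').selmerGroup := by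
  haveI := WeierstrassCurve.neZero_prime_pow p J
  haveI : Finite (W.geomTorsion ((p ^ J : ℕ) : ℤ)) := finite_geomTorsion_of_neZero W _
  refine Summit.BirchSwinnertonDyer.Rank1Residual.GaloisImage.SelmerFinite.finite_selmerGroup_of_isUnramifiedOutside
    (W.twistedTorsionGaloisModule p κ J u hu) (S := twistedDescentPlaces (K := K) p S₀) (fun v' hv' ↦ ?_)
    (W.isUnramifiedOutside_twistedSelmerStructureOfLocal p S₀ κ J u hu L')
  rw [not_mem_twistedDescentPlaces_iff] at hv'
  exact (W.natCast_pow_not_mem_and_isUnramifiedAt_twistedTorsionGaloisModule p κ J u hu (S₀ := (S₀ : Set _))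
    (fun w hw hpw ↦ hbad w (by exact_mod_cast hw) hpw) (by exact_mod_cast hv'.1) hv'.2).2

end Count

section Uniform

variable {K : Type} [Field K] [NumberField K] (W : WeierstrassCurve K) [W.IsElliptic] (p : ℕ) [Fact p.Prime]
  (S₀ : Finset (HeightOneSpectrum (𝓞 K))) (κ : ZpExtension K p) (u : ℤ) (hu : (p : ℤ) ∣ u - 1)
  (L : ∀ (J : ℕ) (v : HeightOneSpectrum (𝓞 K)),
    AddSubgroup (galoisCohomology ((W.twistedTorsionGaloisModule p κ J u hu).restrictField (v.adicCompletion K)) 1))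
  (v : HeightOneSpectrum (𝓞 K)) (hvS : v ∉ S₀) (hpv : ((p : ℕ) : 𝓞 K) ∈ v.asIdeal)
  (hbad : ∀ v' : HeightOneSpectrum (𝓞 K), v' ∉ S₀ → ((p : ℕ) : 𝓞 K) ∉ v'.asIdeal → W.HasGoodReductionAt v')

include hvS hpv hbad

/-- **Uniform-bound corollary (the shape CDF_glob consumes).** For families `X_J`, `K'_J` of conditions at `v` (all levels `J`):
if `#H_{⊥,J} · #(H_{⊤,J} ⧸ H_{K'_J}) ≤ C₁` for all `J` (twist side, HT-2) and each `X_J ⊓ K'_J` is finite with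
`#(X_J ⊓ K'_J) ≤ C₂` (local transversality, HT-1), then `#H_{X_J} ≤ C₁ · C₂` for all `J`. [cite: GreenbergLNM1716, §4 pp. 122–124] -/
theorem natCard_selmerGroup_update_le_uniform
    (X K' : ∀ J : ℕ,
      AddSubgroup (galoisCohomology ((W.twistedTorsionGaloisModule p κ J u hu).restrictField (v.adicCompletion K)) 1))
    {C₁ C₂ : ℕ}
    (htwist : ∀ J : ℕ,
      Nat.card (W.twistedSelmerStructureOfLocal p S₀ κ J u hu (Function.update (L J) v ⊥)).selmerGroup *
        Nat.card ((W.twistedSelmerStructureOfLocal p S₀ κ J u hu (Function.update (L J) v ⊤)).selmerGroup ⧸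
          ((W.twistedSelmerStructureOfLocal p S₀ κ J u hu (Function.update (L J) v (K' J))).selmerGroup).addSubgroupOf
            (W.twistedSelmerStructureOfLocal p S₀ κ J u hu (Function.update (L J) v ⊤)).selmerGroup) ≤ C₁)
    (hloc : ∀ J : ℕ, Finite ↥(X J ⊓ K' J) ∧ Nat.card ↥(X J ⊓ K' J) ≤ C₂) (J : ℕ) :
    Nat.card (W.twistedSelmerStructureOfLocal p S₀ κ J u hu (Function.update (L J) v (X J))).selmerGroup ≤ C₁ * C₂ :=
  (natCard_selmerGroup_update_le W p S₀ κ J u hu (L J) v hvS hpv (X J) (K' J)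
    (finite_selmerGroup_ofLocal W p S₀ κ J u hu hbad _) (hloc J).1).trans
    (Nat.mul_le_mul (htwist J) (hloc J).2)

end Uniform

end OddBlindTwist

end Summit.BirchSwinnertonDyer.BirchSwinnertonDyer.Theorems

end
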